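import Literature.Probability.RandomPlanarGeometry.HexSAWSurfaceFourteenFibreA
import Literature.Probability.RandomPlanarGeometry.HexSAWSurfaceFourteenFibreB
import Literature.Probability.RandomPlanarGeometry.HexSAWSurfaceFourteenFibreC
import Literature.Probability.RandomPlanarGeometry.HexSAWSurfaceFourteenFibreD
import HarnessLib

/-!
# Honeycomb SAW at the Duminil-Copin–Smirnov surface (brick-wall frame): the SIXTH-order term of the adsorbed-phase free energy from above —
# `β(y)² ≤ y + 1/y + 1/y² + 2/y³ + 4/y⁴ + 6/y⁵ + 57395700/y⁶` (`y ≥ 36`) by ELEVEN-step-extendable arches; hence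
# `limsup_{y→∞} y⁵ (β(y)² − y − 1/y − 1/y² − 2/y³ − 4/y⁴) ≤ 6`

Topic `Literature/Probability/RandomPlanarGeometry` (lane «pcv-sawmu», car «WALL-SIXTH-ORDER-UPPER», a-p6 g17).  Continues the same seat's
`HexSAWSurfaceFifthOrderUpper.lean` (seven-step-extendable arches, the twelve-fibre, the fifth coefficient `= 4`; tools `climb_le`, `sum_shape_le_XK'`,
`sum_fibW_dip_le_XK'`, `sum_fibW_ten_le_XK`, `sum_fibW_twelve_le_XK`, `XKw_le_three_pow_mul_pow`), the data module `HexSAWSurfaceFourteenSeeds.lean`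
(the twenty-six shapes `Fourteen.TX/TY`) and the four sibling case-analysis modules `HexSAWSurfaceFourteenFibreA–D` (`fourteen_c1 … fourteen_c19`).

The device.  One order further the same way: under `ExtK 11` and a history of `≥ 11` steps (`j ≥ 9`) the fibre of excursion length FOURTEEN has
EXACTLY the twenty-six shapes of `HexSAWSurfaceFourteenSeeds` (`fourteen_coords11`; lane census `local12.py 14 11 11`: eleven fresh steps are
needed — under nine steps a twenty-seventh shape survives some history), whence the recursion
`X¹¹_{j+16} ≤ y X¹¹_{j+14} + y X¹¹_{j+10} + y X¹¹_{j+8} + 4y X¹¹_{j+6} + 9y X¹¹_{j+4} + 26y X¹¹_{j+2} + 2y Σ_{t ≤ j} X¹¹_t c_{j+15−t}(ℍ)`, the growth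
bound with tail constant `4·3¹⁵ = 57395628`, and the renewal condition at `B = y + 1/y + 1/y² + 2/y³ + 4/y⁴ + 6/y⁵ + 57395700/y⁶` (after
`B ≥ y + 1/y + 1/y² + 2/y³` in `y/B²`, `B ≥ y + 1/y + 1/y²` in `y/B³`, `B ≥ y + 1/y` in `4y/B⁴` and `B ≥ y` elsewhere, a degree-25 polynomial
inequality whose coefficients in `y − 1` are all positive).  The coefficient `6 = 26 − 20` is the lane's census conjecture for the sixth term
(REPORT v1.8: `μ(y)² = y + 1/y + 1/y² + 2/y³ + 4/y⁴ + 6/y⁵ + O(y⁻⁶)`); this module proves the upper half.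

Sources.  N. R. Beaton, M. Bousquet-Mélou, J. de Gier, H. Duminil-Copin, A. J. Guttmann, CMP 326 (2014) = arXiv:1109.0358v5, §3.1, Proposition 5
(p. 9) and p. 10 (first-order remark).  E. J. Janse van Rensburg (OUP 2000), §3.3.2, Lemma 3.20.  J. M. Hammersley, G. M. Torrie, S. G. Whittington,
J. Phys. A 15 (1982) 539, §2 (locator provisional, source not held).  I. G. Enting, I. Jensen, LNP 775 (2009), §7.4.2, Fig. 7.10.  N. Madras, G. Slade
(1993), §1.1–§1.2.

## What is proved (namespace `…SAW.HexBW.Wall`)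

* `fourteen_c20`, `fourteen_main_gen` (top of the generated case analysis); `sum_fibW_flat8_le_XK'` (`3 ≤ k`, no upper bound on `k`).
* ★★★ **`fourteen_coords11 (9 ≤ j) (11 ≤ k) : ∃ s : Fin 26, ∀ i ≤ 14, ω (j+2+i) = (X_{j+2} + Fourteen.TX s i · σ, Fourteen.TY s i)`**;
  ★★ `sum_fibW_fourteen_le_XK : Σ ≤ 26y · X^{(k)}_{j+2}`.
* ★★ **`X11w_le_rec (9 ≤ j)`**, `X11w_le_mul_pow` (`6 ≤ ρ`, `… + 26y/ρ¹⁴ + 57395628 y/ρ¹⁶ ≤ 1 ⇒ X¹¹_n ≤ 3²⁴ y²⁴ ρⁿ`).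
* `sixth_poly_nonneg`, `sixthB_condition`, ★★★ **`wallRate_sq_le_sixth (36 ≤ y) : β(y)² ≤ y + 1/y + 1/y² + 2/y³ + 4/y⁴ + 6/y⁵ + 57395700/y⁶`**,
  ★★★ `pow_five_mul_wallRate_sq_sub_le : y⁵ (β² − y − 1/y − 1/y² − 2/y³ − 4/y⁴) ≤ 6 + 57395700/y`, `eventually_pow_five_mul_wallRate_sq_sub_le (6 < a)`
  (limsup ≤ 6), `wallRate_sq_fifth_mem_Icc'`, and the `μ(y)` versions.

HONEST LABEL (author's proposal).  LANE THEOREM M, elementary, no new definitions; NEW-IN-WRITING (modest): the sixth coefficient of the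
strong-adsorption expansion of the Duminil-Copin–Smirnov-surface growth rate is `≤ 6` (print has first order only, BBdGDCG p. 10).  NOT CLAIMED:
the matching lower bound (`≥ 6`), `y < 36`, optimal constants, the armchair wall.
-/

noncomputable section

open Finset Filter Function
open Literature.Probability.LatticeModels Literature.Probability.Percolation SimpleGraph
open _root_.Topology

namespace Literature.Probability.RandomPlanarGeometry.SAW.HexBW.Wall

variable {y : ℝ} {n k : ℕ} {ω : ℕ → Site 2}

set_option maxHeartbeats 400000 in
/-- Case analysis of the fourteen-fibre under 11-step extendability (generated; 29 steps): branch excursion prefix ⟨(1, 0), (1, -1)⟩. [cite: EntingJensen2009, §7.4.2, Fig. 7.10 (brickwork form of the honeycomb lattice); HammersleyTorrieWhittington1982, §2] -/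
theorem fourteen_c20 {j : ℕ} (hj : 9 ≤ j) (hωh : ω ∈ hpw (j + 16)) (hend : ω (j + 16) 1 = 0) (hkY : ω (j + 2) 1 = 0)
    (hno : ∀ i, j + 2 < i → i ≤ j + 14 → ¬ (i % 2 = 0 ∧ ω i 1 = 0)) (hE : ExtK k (j + 16) ω) (hk : 11 ≤ k)
    (hX2 : ω (j + 2) 0 = ω (j + 1) 0 + 1 ∨ ω (j + 1) 0 = ω (j + 2) 0 + 1) (hY1 : ω (j + 1) 1 = 0) (hxe : ω (j + 2) 0 % 2 = 0) (hj2 : j % 2 = 0)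
    (h3 : ω (j + 3) 0 = 2 * ω (j + 2) 0 - ω (j + 1) 0 ∧ ω (j + 3) 1 = 0) (h4 : ω (j + 4) 0 = 2 * ω (j + 2) 0 - ω (j + 1) 0 ∧ ω (j + 4) 1 = -1)
    : ∃ s : Fin 26, ∀ i ≤ 14, ω (j + 2 + i) 0 = ω (j + 2) 0 + Fourteen.TX s i * (ω (j + 2) 0 - ω (j + 1) 0) ∧ ω (j + 2 + i) 1 = Fourteen.TY s i := by
  obtain ⟨x3, y3⟩ := h3; obtain ⟨x4, y4⟩ := h4
  have A : (ω (j + 5) 0 = 3 * ω (j + 2) 0 - 2 * ω (j + 1) 0 ∧ ω (j + 5) 1 = -1) ∨ (ω (j + 5) 0 = ω (j + 2) 0 ∧ ω (j + 5) 1 = -1) ∨ (ω (j + 5) 0 = 2 * ω (j + 2) 0 - ω (j + 1) 0 ∧ ω (j + 5) 1 = 0) := by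
    have s := hpw_step hωh (a := j + 4) (b := j + 5) (by omega) (by omega); clear * - s x4 y4 hX2 hxe; omega
  rcases A with ⟨x5, y5⟩ | ⟨x5, y5⟩ | ⟨x5, y5⟩
  · have A : (ω (j + 6) 0 = 4 * ω (j + 2) 0 - 3 * ω (j + 1) 0 ∧ ω (j + 6) 1 = -1) ∨ (ω (j + 6) 0 = 2 * ω (j + 2) 0 - ω (j + 1) 0 ∧ ω (j + 6) 1 = -1) ∨ (ω (j + 6) 0 = 3 * ω (j + 2) 0 - 2 * ω (j + 1) 0 ∧ ω (j + 6) 1 = -2) := by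
      have s := hpw_step hωh (a := j + 5) (b := j + 6) (by omega) (by omega); clear * - s x5 y5 hX2 hxe; omega
    rcases A with ⟨x6, y6⟩ | ⟨x6, y6⟩ | ⟨x6, y6⟩
    · have A : (ω (j + 7) 0 = 5 * ω (j + 2) 0 - 4 * ω (j + 1) 0 ∧ ω (j + 7) 1 = -1) ∨ (ω (j + 7) 0 = 3 * ω (j + 2) 0 - 2 * ω (j + 1) 0 ∧ ω (j + 7) 1 = -1) ∨ (ω (j + 7) 0 = 4 * ω (j + 2) 0 - 3 * ω (j + 1) 0 ∧ ω (j + 7) 1 = 0) := by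
        have s := hpw_step hωh (a := j + 6) (b := j + 7) (by omega) (by omega); clear * - s x6 y6 hX2 hxe; omega
      rcases A with ⟨x7, y7⟩ | ⟨x7, y7⟩ | ⟨x7, y7⟩
      · have A : (ω (j + 8) 0 = 6 * ω (j + 2) 0 - 5 * ω (j + 1) 0 ∧ ω (j + 8) 1 = -1) ∨ (ω (j + 8) 0 = 4 * ω (j + 2) 0 - 3 * ω (j + 1) 0 ∧ ω (j + 8) 1 = -1) ∨ (ω (j + 8) 0 = 5 * ω (j + 2) 0 - 4 * ω (j + 1) 0 ∧ ω (j + 8) 1 = -2) := by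
          have s := hpw_step hωh (a := j + 7) (b := j + 8) (by omega) (by omega); clear * - s x7 y7 hX2 hxe; omega
        rcases A with ⟨x8, y8⟩ | ⟨x8, y8⟩ | ⟨x8, y8⟩
        · have A : (ω (j + 9) 0 = 7 * ω (j + 2) 0 - 6 * ω (j + 1) 0 ∧ ω (j + 9) 1 = -1) ∨ (ω (j + 9) 0 = 5 * ω (j + 2) 0 - 4 * ω (j + 1) 0 ∧ ω (j + 9) 1 = -1) ∨ (ω (j + 9) 0 = 6 * ω (j + 2) 0 - 5 * ω (j + 1) 0 ∧ ω (j + 9) 1 = 0) := by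
            have s := hpw_step hωh (a := j + 8) (b := j + 9) (by omega) (by omega); clear * - s x8 y8 hX2 hxe; omega
          rcases A with ⟨x9, y9⟩ | ⟨x9, y9⟩ | ⟨x9, y9⟩
          · exact fourteen_c1 hωh hend hkY hno hE hk hX2 hxe hj2 ⟨x3, y3⟩ ⟨x4, y4⟩ ⟨x5, y5⟩ ⟨x6, y6⟩ ⟨x7, y7⟩ ⟨x8, y8⟩ ⟨x9, y9⟩
          · exact (clash hωh (x9.trans x7.symm) (y9.trans y7.symm) (by omega) (by omega) (by omega)).elim
          · have A : (ω (j + 10) 0 = 7 * ω (j + 2) 0 - 6 * ω (j + 1) 0 ∧ ω (j + 10) 1 = 0) ∨ (ω (j + 10) 0 = 5 * ω (j + 2) 0 - 4 * ω (j + 1) 0 ∧ ω (j + 10) 1 = 0) ∨ (ω (j + 10) 0 = 6 * ω (j + 2) 0 - 5 * ω (j + 1) 0 ∧ ω (j + 10) 1 = -1) := by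
              have s := hpw_step hωh (a := j + 9) (b := j + 10) (by omega) (by omega); clear * - s x9 y9 hX2 hxe; omega
            rcases A with ⟨x10, y10⟩ | ⟨x10, y10⟩ | ⟨x10, y10⟩
            · exact (hno (j + 10) (by omega) (by omega) ⟨by omega, y10⟩).elim
            · exact (hno (j + 10) (by omega) (by omega) ⟨by omega, y10⟩).elim
            · exact (clash hωh (x10.trans x8.symm) (y10.trans y8.symm) (by omega) (by omega) (by omega)).elim
        · exact (clash hωh (x8.trans x6.symm) (y8.trans y6.symm) (by omega) (by omega) (by omega)).elim
        · exact fourteen_c3 hωh hend hkY hno hE hk hX2 hY1 hxe hj2 ⟨x3, y3⟩ ⟨x4, y4⟩ ⟨x5, y5⟩ ⟨x6, y6⟩ ⟨x7, y7⟩ ⟨x8, y8⟩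
      · exact (clash hωh (x7.trans x5.symm) (y7.trans y5.symm) (by omega) (by omega) (by omega)).elim
      · have A : (ω (j + 8) 0 = 5 * ω (j + 2) 0 - 4 * ω (j + 1) 0 ∧ ω (j + 8) 1 = 0) ∨ (ω (j + 8) 0 = 3 * ω (j + 2) 0 - 2 * ω (j + 1) 0 ∧ ω (j + 8) 1 = 0) ∨ (ω (j + 8) 0 = 4 * ω (j + 2) 0 - 3 * ω (j + 1) 0 ∧ ω (j + 8) 1 = -1) := by
          have s := hpw_step hωh (a := j + 7) (b := j + 8) (by omega) (by omega); clear * - s x7 y7 hX2 hxe; omega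
        rcases A with ⟨x8, y8⟩ | ⟨x8, y8⟩ | ⟨x8, y8⟩
        · exact (hno (j + 8) (by omega) (by omega) ⟨by omega, y8⟩).elim
        · exact (hno (j + 8) (by omega) (by omega) ⟨by omega, y8⟩).elim
        · exact (clash hωh (x8.trans x6.symm) (y8.trans y6.symm) (by omega) (by omega) (by omega)).elim
    · exact (clash hωh (x6.trans x4.symm) (y6.trans y4.symm) (by omega) (by omega) (by omega)).elim
    · have A : (ω (j + 7) 0 = 4 * ω (j + 2) 0 - 3 * ω (j + 1) 0 ∧ ω (j + 7) 1 = -2) ∨ (ω (j + 7) 0 = 2 * ω (j + 2) 0 - ω (j + 1) 0 ∧ ω (j + 7) 1 = -2) ∨ (ω (j + 7) 0 = 3 * ω (j + 2) 0 - 2 * ω (j + 1) 0 ∧ ω (j + 7) 1 = -1) := by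
        have s := hpw_step hωh (a := j + 6) (b := j + 7) (by omega) (by omega); clear * - s x6 y6 hX2 hxe; omega
      rcases A with ⟨x7, y7⟩ | ⟨x7, y7⟩ | ⟨x7, y7⟩
      · exact fourteen_c8 hωh hend hkY hno hE hk hX2 hY1 hxe hj2 ⟨x3, y3⟩ ⟨x4, y4⟩ ⟨x5, y5⟩ ⟨x6, y6⟩ ⟨x7, y7⟩
      · have A : (ω (j + 8) 0 = 3 * ω (j + 2) 0 - 2 * ω (j + 1) 0 ∧ ω (j + 8) 1 = -2) ∨ (ω (j + 8) 0 = ω (j + 2) 0 ∧ ω (j + 8) 1 = -2) ∨ (ω (j + 8) 0 = 2 * ω (j + 2) 0 - ω (j + 1) 0 ∧ ω (j + 8) 1 = -3) := by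
          have s := hpw_step hωh (a := j + 7) (b := j + 8) (by omega) (by omega); clear * - s x7 y7 hX2 hxe; omega
        rcases A with ⟨x8, y8⟩ | ⟨x8, y8⟩ | ⟨x8, y8⟩
        · exact (clash hωh (x8.trans x6.symm) (y8.trans y6.symm) (by omega) (by omega) (by omega)).elim
        · have A : (ω (j + 9) 0 = 2 * ω (j + 2) 0 - ω (j + 1) 0 ∧ ω (j + 9) 1 = -2) ∨ (ω (j + 9) 0 = ω (j + 1) 0 ∧ ω (j + 9) 1 = -2) ∨ (ω (j + 9) 0 = ω (j + 2) 0 ∧ ω (j + 9) 1 = -1) := by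
            have s := hpw_step hωh (a := j + 8) (b := j + 9) (by omega) (by omega); clear * - s x8 y8 hX2 hxe; omega
          rcases A with ⟨x9, y9⟩ | ⟨x9, y9⟩ | ⟨x9, y9⟩
          · exact (clash hωh (x9.trans x7.symm) (y9.trans y7.symm) (by omega) (by omega) (by omega)).elim
          · have A : (ω (j + 10) 0 = ω (j + 2) 0 ∧ ω (j + 10) 1 = -2) ∨ (ω (j + 10) 0 = 2 * ω (j + 1) 0 - ω (j + 2) 0 ∧ ω (j + 10) 1 = -2) ∨ (ω (j + 10) 0 = ω (j + 1) 0 ∧ ω (j + 10) 1 = -3) := by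
              have s := hpw_step hωh (a := j + 9) (b := j + 10) (by omega) (by omega); clear * - s x9 y9 hX2 hxe; omega
            rcases A with ⟨x10, y10⟩ | ⟨x10, y10⟩ | ⟨x10, y10⟩
            · exact (clash hωh (x10.trans x8.symm) (y10.trans y8.symm) (by omega) (by omega) (by omega)).elim
            · exact fourteen_c9 hj hωh hend hkY hX2 hY1 hxe hj2 ⟨x4, y4⟩ ⟨x8, y8⟩ ⟨x9, y9⟩ ⟨x10, y10⟩
            · have A : (ω (j + 11) 0 = ω (j + 2) 0 ∧ ω (j + 11) 1 = -3) ∨ (ω (j + 11) 0 = 2 * ω (j + 1) 0 - ω (j + 2) 0 ∧ ω (j + 11) 1 = -3) ∨ (ω (j + 11) 0 = ω (j + 1) 0 ∧ ω (j + 11) 1 = -2) := by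
                have s := hpw_step hωh (a := j + 10) (b := j + 11) (by omega) (by omega); clear * - s x10 y10 hX2 hxe; omega
              rcases A with ⟨x11, y11⟩ | ⟨x11, y11⟩ | ⟨x11, y11⟩
              · have hcl := climb_le_odd (hpw_subset hωh) (t := j + 11) (s := 5) (by omega) (by omega)
                rw [show j + 11 + 5 = j + 16 by omega] at hcl; clear * - hcl hend y11; exfalso; omega
              · have hcl := climb_le_odd (hpw_subset hωh) (t := j + 11) (s := 5) (by omega) (by omega)
                rw [show j + 11 + 5 = j + 16 by omega] at hcl; clear * - hcl hend y11; exfalso; omega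
              · exact (clash hωh (x11.trans x9.symm) (y11.trans y9.symm) (by omega) (by omega) (by omega)).elim
          · have A : (ω (j + 10) 0 = 2 * ω (j + 2) 0 - ω (j + 1) 0 ∧ ω (j + 10) 1 = -1) ∨ (ω (j + 10) 0 = ω (j + 1) 0 ∧ ω (j + 10) 1 = -1) ∨ (ω (j + 10) 0 = ω (j + 2) 0 ∧ ω (j + 10) 1 = -2) := by
              have s := hpw_step hωh (a := j + 9) (b := j + 10) (by omega) (by omega); clear * - s x9 y9 hX2 hxe; omega
            rcases A with ⟨x10, y10⟩ | ⟨x10, y10⟩ | ⟨x10, y10⟩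
            · exact (clash hωh (x10.trans x4.symm) (y10.trans y4.symm) (by omega) (by omega) (by omega)).elim
            · have A : (ω (j + 11) 0 = ω (j + 2) 0 ∧ ω (j + 11) 1 = -1) ∨ (ω (j + 11) 0 = 2 * ω (j + 1) 0 - ω (j + 2) 0 ∧ ω (j + 11) 1 = -1) ∨ (ω (j + 11) 0 = ω (j + 1) 0 ∧ ω (j + 11) 1 = 0) := by
                have s := hpw_step hωh (a := j + 10) (b := j + 11) (by omega) (by omega); clear * - s x10 y10 hX2 hxe; omega
              rcases A with ⟨x11, y11⟩ | ⟨x11, y11⟩ | ⟨x11, y11⟩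
              · exact (clash hωh (x11.trans x9.symm) (y11.trans y9.symm) (by omega) (by omega) (by omega)).elim
              · have A : (ω (j + 12) 0 = ω (j + 1) 0 ∧ ω (j + 12) 1 = -1) ∨ (ω (j + 12) 0 = 3 * ω (j + 1) 0 - 2 * ω (j + 2) 0 ∧ ω (j + 12) 1 = -1) ∨ (ω (j + 12) 0 = 2 * ω (j + 1) 0 - ω (j + 2) 0 ∧ ω (j + 12) 1 = -2) := by
                  have s := hpw_step hωh (a := j + 11) (b := j + 12) (by omega) (by omega); clear * - s x11 y11 hX2 hxe; omega
                rcases A with ⟨x12, y12⟩ | ⟨x12, y12⟩ | ⟨x12, y12⟩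
                · exact (clash hωh (x12.trans x10.symm) (y12.trans y10.symm) (by omega) (by omega) (by omega)).elim
                · have A : (ω j 0 = ω (j + 2) 0 ∧ ω j 1 = 0) ∨ (ω j 0 = 2 * ω (j + 1) 0 - ω (j + 2) 0 ∧ ω j 1 = 0) ∨ (ω j 0 = ω (j + 1) 0 ∧ ω j 1 = -1) := by
                    have s := hpw_step hωh (a := j) (b := j + 1) (by omega) (by omega); clear * - s hY1 hX2 hxe; omega
                  rcases A with ⟨x0, y0⟩ | ⟨x0, y0⟩ | ⟨x0, y0⟩
                  · exact (clash hωh x0 (y0.trans hkY.symm) (by omega) (by omega) (by omega)).elim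
                  · have A : (ω (j - 1) 0 = ω (j + 1) 0 ∧ ω (j - 1) 1 = 0) ∨ (ω (j - 1) 0 = 3 * ω (j + 1) 0 - 2 * ω (j + 2) 0 ∧ ω (j - 1) 1 = 0) := by
                      have s := hpw_step hωh (a := j - 1) (b := j) (by omega) (by omega); clear * - s x0 y0 hX2 hxe; omega
                    rcases A with ⟨xm1, ym1⟩ | ⟨xm1, ym1⟩
                    · exact (clash hωh xm1 (ym1.trans hY1.symm) (by omega) (by omega) (by omega)).elim
                    · have A : (ω (j + 13) 0 = 2 * ω (j + 1) 0 - ω (j + 2) 0 ∧ ω (j + 13) 1 = -1) ∨ (ω (j + 13) 0 = 4 * ω (j + 1) 0 - 3 * ω (j + 2) 0 ∧ ω (j + 13) 1 = -1) ∨ (ω (j + 13) 0 = 3 * ω (j + 1) 0 - 2 * ω (j + 2) 0 ∧ ω (j + 13) 1 = 0) := by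
                        have s := hpw_step hωh (a := j + 12) (b := j + 13) (by omega) (by omega); clear * - s x12 y12 hX2 hxe; omega
                      rcases A with ⟨x13, y13⟩ | ⟨x13, y13⟩ | ⟨x13, y13⟩
                      · exact (clash hωh (x13.trans x11.symm) (y13.trans y11.symm) (by omega) (by omega) (by omega)).elim
                      · have A : (ω (j + 14) 0 = 3 * ω (j + 1) 0 - 2 * ω (j + 2) 0 ∧ ω (j + 14) 1 = -1) ∨ (ω (j + 14) 0 = 5 * ω (j + 1) 0 - 4 * ω (j + 2) 0 ∧ ω (j + 14) 1 = -1) ∨ (ω (j + 14) 0 = 4 * ω (j + 1) 0 - 3 * ω (j + 2) 0 ∧ ω (j + 14) 1 = -2) := by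
                          have s := hpw_step hωh (a := j + 13) (b := j + 14) (by omega) (by omega); clear * - s x13 y13 hX2 hxe; omega
                        rcases A with ⟨x14, y14⟩ | ⟨x14, y14⟩ | ⟨x14, y14⟩
                        · exact (clash hωh (x14.trans x12.symm) (y14.trans y12.symm) (by omega) (by omega) (by omega)).elim
                        · have A : (ω (j + 15) 0 = 4 * ω (j + 1) 0 - 3 * ω (j + 2) 0 ∧ ω (j + 15) 1 = -1) ∨ (ω (j + 15) 0 = 6 * ω (j + 1) 0 - 5 * ω (j + 2) 0 ∧ ω (j + 15) 1 = -1) ∨ (ω (j + 15) 0 = 5 * ω (j + 1) 0 - 4 * ω (j + 2) 0 ∧ ω (j + 15) 1 = 0) := by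
                            have s := hpw_step hωh (a := j + 14) (b := j + 15) (by omega) (by omega); clear * - s x14 y14 hX2 hxe; omega
                          rcases A with ⟨x15, y15⟩ | ⟨x15, y15⟩ | ⟨x15, y15⟩
                          · exact (clash hωh (x15.trans x13.symm) (y15.trans y13.symm) (by omega) (by omega) (by omega)).elim
                          · have hcl := climb_le_odd (hpw_subset hωh) (t := j + 15) (s := 1) (by omega) (by omega)
                            rw [show j + 15 + 1 = j + 16 by omega] at hcl; clear * - hcl hend y15; exfalso; omega
                          · have A : (ω (j - 2) 0 = 2 * ω (j + 1) 0 - ω (j + 2) 0 ∧ ω (j - 2) 1 = 0) ∨ (ω (j - 2) 0 = 4 * ω (j + 1) 0 - 3 * ω (j + 2) 0 ∧ ω (j - 2) 1 = 0) ∨ (ω (j - 2) 0 = 3 * ω (j + 1) 0 - 2 * ω (j + 2) 0 ∧ ω (j - 2) 1 = -1) := by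
                              have s := hpw_step hωh (a := j - 2) (b := j - 1) (by omega) (by omega); clear * - s xm1 ym1 hX2 hxe; omega
                            rcases A with ⟨xm2, ym2⟩ | ⟨xm2, ym2⟩ | ⟨xm2, ym2⟩
                            · exact (clash hωh (xm2.trans x0.symm) (ym2.trans y0.symm) (by omega) (by omega) (by omega)).elim
                            · have A : (ω (j - 3) 0 = 3 * ω (j + 1) 0 - 2 * ω (j + 2) 0 ∧ ω (j - 3) 1 = 0) ∨ (ω (j - 3) 0 = 5 * ω (j + 1) 0 - 4 * ω (j + 2) 0 ∧ ω (j - 3) 1 = 0) := by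
                                have s := hpw_step hωh (a := j - 3) (b := j - 2) (by omega) (by omega); clear * - s xm2 ym2 hX2 hxe; omega
                              rcases A with ⟨xm3, ym3⟩ | ⟨xm3, ym3⟩
                              · exact (clash hωh (xm3.trans xm1.symm) (ym3.trans ym1.symm) (by omega) (by omega) (by omega)).elim
                              · exact (clash hωh (xm3.trans x15.symm) (ym3.trans y15.symm) (by omega) (by omega) (by omega)).elim
                            · exact (clash hωh (xm2.trans x12.symm) (ym2.trans y12.symm) (by omega) (by omega) (by omega)).elim
                        · have hcl := climb_le_even (hpw_subset hωh) (t := j + 14) (s := 2) (by omega) (by omega)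
                          rw [show j + 14 + 2 = j + 16 by omega] at hcl; clear * - hcl hend y14; exfalso; omega
                      · exact (clash hωh (x13.trans xm1.symm) (y13.trans ym1.symm) (by omega) (by omega) (by omega)).elim
                  · exact (clash hωh (x0.trans x10.symm) (y0.trans y10.symm) (by omega) (by omega) (by omega)).elim
                · have A : (ω (j + 13) 0 = ω (j + 1) 0 ∧ ω (j + 13) 1 = -2) ∨ (ω (j + 13) 0 = 3 * ω (j + 1) 0 - 2 * ω (j + 2) 0 ∧ ω (j + 13) 1 = -2) ∨ (ω (j + 13) 0 = 2 * ω (j + 1) 0 - ω (j + 2) 0 ∧ ω (j + 13) 1 = -1) := by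
                    have s := hpw_step hωh (a := j + 12) (b := j + 13) (by omega) (by omega); clear * - s x12 y12 hX2 hxe; omega
                  rcases A with ⟨x13, y13⟩ | ⟨x13, y13⟩ | ⟨x13, y13⟩
                  · have hcl := climb_le_odd (hpw_subset hωh) (t := j + 13) (s := 3) (by omega) (by omega)
                    rw [show j + 13 + 3 = j + 16 by omega] at hcl; clear * - hcl hend y13; exfalso; omega
                  · have hcl := climb_le_odd (hpw_subset hωh) (t := j + 13) (s := 3) (by omega) (by omega)
                    rw [show j + 13 + 3 = j + 16 by omega] at hcl; clear * - hcl hend y13; exfalso; omega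
                  · exact (clash hωh (x13.trans x11.symm) (y13.trans y11.symm) (by omega) (by omega) (by omega)).elim
              · exact (clash hωh x11 (y11.trans hY1.symm) (by omega) (by omega) (by omega)).elim
            · exact (clash hωh (x10.trans x8.symm) (y10.trans y8.symm) (by omega) (by omega) (by omega)).elim
        · exact fourteen_c10 hj hωh hend hkY hE hk hX2 hY1 hxe hj2 ⟨x3, y3⟩ ⟨x4, y4⟩ ⟨x5, y5⟩ ⟨x6, y6⟩ ⟨x7, y7⟩ ⟨x8, y8⟩
      · exact (clash hωh (x7.trans x5.symm) (y7.trans y5.symm) (by omega) (by omega) (by omega)).elim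
  · have A : (ω (j + 6) 0 = 2 * ω (j + 2) 0 - ω (j + 1) 0 ∧ ω (j + 6) 1 = -1) ∨ (ω (j + 6) 0 = ω (j + 1) 0 ∧ ω (j + 6) 1 = -1) ∨ (ω (j + 6) 0 = ω (j + 2) 0 ∧ ω (j + 6) 1 = -2) := by
      have s := hpw_step hωh (a := j + 5) (b := j + 6) (by omega) (by omega); clear * - s x5 y5 hX2 hxe; omega
    rcases A with ⟨x6, y6⟩ | ⟨x6, y6⟩ | ⟨x6, y6⟩
    · exact (clash hωh (x6.trans x4.symm) (y6.trans y4.symm) (by omega) (by omega) (by omega)).elim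
    · have A : (ω (j + 7) 0 = ω (j + 2) 0 ∧ ω (j + 7) 1 = -1) ∨ (ω (j + 7) 0 = 2 * ω (j + 1) 0 - ω (j + 2) 0 ∧ ω (j + 7) 1 = -1) ∨ (ω (j + 7) 0 = ω (j + 1) 0 ∧ ω (j + 7) 1 = 0) := by
        have s := hpw_step hωh (a := j + 6) (b := j + 7) (by omega) (by omega); clear * - s x6 y6 hX2 hxe; omega
      rcases A with ⟨x7, y7⟩ | ⟨x7, y7⟩ | ⟨x7, y7⟩
      · exact (clash hωh (x7.trans x5.symm) (y7.trans y5.symm) (by omega) (by omega) (by omega)).elim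
      · have A : (ω j 0 = ω (j + 2) 0 ∧ ω j 1 = 0) ∨ (ω j 0 = 2 * ω (j + 1) 0 - ω (j + 2) 0 ∧ ω j 1 = 0) ∨ (ω j 0 = ω (j + 1) 0 ∧ ω j 1 = -1) := by
          have s := hpw_step hωh (a := j) (b := j + 1) (by omega) (by omega); clear * - s hY1 hX2 hxe; omega
        rcases A with ⟨x0, y0⟩ | ⟨x0, y0⟩ | ⟨x0, y0⟩
        · exact (clash hωh x0 (y0.trans hkY.symm) (by omega) (by omega) (by omega)).elim
        · have A : (ω (j - 1) 0 = ω (j + 1) 0 ∧ ω (j - 1) 1 = 0) ∨ (ω (j - 1) 0 = 3 * ω (j + 1) 0 - 2 * ω (j + 2) 0 ∧ ω (j - 1) 1 = 0) := by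
            have s := hpw_step hωh (a := j - 1) (b := j) (by omega) (by omega); clear * - s x0 y0 hX2 hxe; omega
          rcases A with ⟨xm1, ym1⟩ | ⟨xm1, ym1⟩
          · exact (clash hωh xm1 (ym1.trans hY1.symm) (by omega) (by omega) (by omega)).elim
          · exact fourteen_c12 hj hωh hend hkY hE hk hX2 hxe hj2 ⟨xm1, ym1⟩ ⟨x0, y0⟩ ⟨x3, y3⟩ ⟨x4, y4⟩ ⟨x5, y5⟩ ⟨x6, y6⟩ ⟨x7, y7⟩
        · exact (clash hωh (x0.trans x6.symm) (y0.trans y6.symm) (by omega) (by omega) (by omega)).elim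
      · exact (clash hωh x7 (y7.trans hY1.symm) (by omega) (by omega) (by omega)).elim
    · have A : (ω (j + 7) 0 = 2 * ω (j + 2) 0 - ω (j + 1) 0 ∧ ω (j + 7) 1 = -2) ∨ (ω (j + 7) 0 = ω (j + 1) 0 ∧ ω (j + 7) 1 = -2) ∨ (ω (j + 7) 0 = ω (j + 2) 0 ∧ ω (j + 7) 1 = -1) := by
        have s := hpw_step hωh (a := j + 6) (b := j + 7) (by omega) (by omega); clear * - s x6 y6 hX2 hxe; omega
      rcases A with ⟨x7, y7⟩ | ⟨x7, y7⟩ | ⟨x7, y7⟩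
      · have A : (ω (j + 8) 0 = 3 * ω (j + 2) 0 - 2 * ω (j + 1) 0 ∧ ω (j + 8) 1 = -2) ∨ (ω (j + 8) 0 = ω (j + 2) 0 ∧ ω (j + 8) 1 = -2) ∨ (ω (j + 8) 0 = 2 * ω (j + 2) 0 - ω (j + 1) 0 ∧ ω (j + 8) 1 = -3) := by
          have s := hpw_step hωh (a := j + 7) (b := j + 8) (by omega) (by omega); clear * - s x7 y7 hX2 hxe; omega
        rcases A with ⟨x8, y8⟩ | ⟨x8, y8⟩ | ⟨x8, y8⟩
        · exact fourteen_c14 hωh hend hkY hno hE hk hX2 hxe hj2 ⟨x3, y3⟩ ⟨x4, y4⟩ ⟨x5, y5⟩ ⟨x6, y6⟩ ⟨x7, y7⟩ ⟨x8, y8⟩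
        · exact (clash hωh (x8.trans x6.symm) (y8.trans y6.symm) (by omega) (by omega) (by omega)).elim
        · exact fourteen_c15 hj hωh hend hkY hE hk hX2 hY1 hxe hj2 ⟨x3, y3⟩ ⟨x4, y4⟩ ⟨x5, y5⟩ ⟨x6, y6⟩ ⟨x7, y7⟩ ⟨x8, y8⟩
      · exact fourteen_c19 hj hωh hend hkY hE hk hX2 hY1 hxe hj2 ⟨x3, y3⟩ ⟨x4, y4⟩ ⟨x5, y5⟩ ⟨x6, y6⟩ ⟨x7, y7⟩
      · exact (clash hωh (x7.trans x5.symm) (y7.trans y5.symm) (by omega) (by omega) (by omega)).elim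
  · exact (clash hωh (x5.trans x3.symm) (y5.trans y3.symm) (by omega) (by omega) (by omega)).elim

/-- ★★ Case analysis of the fourteen-fibre under 11-step extendability (generated; 2 steps): the nine admissible excursions. [cite: EntingJensen2009, §7.4.2, Fig. 7.10 (brickwork form of the honeycomb lattice); HammersleyTorrieWhittington1982, §2] -/
theorem fourteen_main_gen {j : ℕ} (hj : 9 ≤ j) (hωh : ω ∈ hpw (j + 16)) (hend : ω (j + 16) 1 = 0) (hkY : ω (j + 2) 1 = 0)
    (hno : ∀ i, j + 2 < i → i ≤ j + 14 → ¬ (i % 2 = 0 ∧ ω i 1 = 0)) (hE : ExtK k (j + 16) ω) (hk : 11 ≤ k)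
    (hX2 : ω (j + 2) 0 = ω (j + 1) 0 + 1 ∨ ω (j + 1) 0 = ω (j + 2) 0 + 1) (hY1 : ω (j + 1) 1 = 0) (hxe : ω (j + 2) 0 % 2 = 0) (hj2 : j % 2 = 0)
    : ∃ s : Fin 26, ∀ i ≤ 14, ω (j + 2 + i) 0 = ω (j + 2) 0 + Fourteen.TX s i * (ω (j + 2) 0 - ω (j + 1) 0) ∧ ω (j + 2 + i) 1 = Fourteen.TY s i := by
  have A : (ω (j + 3) 0 = 2 * ω (j + 2) 0 - ω (j + 1) 0 ∧ ω (j + 3) 1 = 0) ∨ (ω (j + 3) 0 = ω (j + 1) 0 ∧ ω (j + 3) 1 = 0) := by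
    have s := hpw_step hωh (a := j + 2) (b := j + 3) (by omega) (by omega); clear * - s hkY hX2 hxe; omega
  rcases A with ⟨x3, y3⟩ | ⟨x3, y3⟩
  · have A : (ω (j + 4) 0 = 3 * ω (j + 2) 0 - 2 * ω (j + 1) 0 ∧ ω (j + 4) 1 = 0) ∨ (ω (j + 4) 0 = ω (j + 2) 0 ∧ ω (j + 4) 1 = 0) ∨ (ω (j + 4) 0 = 2 * ω (j + 2) 0 - ω (j + 1) 0 ∧ ω (j + 4) 1 = -1) := by
      have s := hpw_step hωh (a := j + 3) (b := j + 4) (by omega) (by omega); clear * - s x3 y3 hX2 hxe; omega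
    rcases A with ⟨x4, y4⟩ | ⟨x4, y4⟩ | ⟨x4, y4⟩
    · exact (hno (j + 4) (by omega) (by omega) ⟨by omega, y4⟩).elim
    · exact (clash hωh x4 (y4.trans hkY.symm) (by omega) (by omega) (by omega)).elim
    · exact fourteen_c20 hj hωh hend hkY hno hE hk hX2 hY1 hxe hj2 ⟨x3, y3⟩ ⟨x4, y4⟩
  · exact (clash hωh x3 (y3.trans hY1.symm) (by omega) (by omega) (by omega)).elim


/-! ### THE FOURTEEN-FIBRE UNDER ELEVEN-STEP EXTENDABILITY -/

open Classical in
/-- **The flat fibre under `k`-step extendability, for every `k ≥ 3`** (the parent's `sum_fibW_flat8_le_XK` needs `k ≤ 8`; here the excursion plus the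
fresh continuation witness extendability of the prefix). [cite: EntingJensen2009, §7.4.2, Fig. 7.10; HammersleyTorrieWhittington1982, §2] -/
theorem sum_fibW_flat8_le_XK' {j : ℕ} (hj : 1 ≤ j) (hy : 0 ≤ y) (hk3 : 3 ≤ k) :
    ∑ ω ∈ (fibW (j + 6) (j + 2)).filter (ExtK k (j + 10)), y ^ visits (j + 10) ω ≤ y * XKw k (j + 2) y := by
  refine sum_shape_le_XK' (c := 6) hy flatD flatE _ (fun ω hω => hω) fun ω hω i hi => ?_
  obtain ⟨hωf, hE⟩ := Finset.mem_filter.1 hω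
  exact flat8_coordsK hj hωf hE hk3 i hi

/-- ★★★ **THE FOURTEEN-FIBRE UNDER ELEVEN-STEP EXTENDABILITY** (`j ≥ 9`, `k ≥ 11`): an arch of length `j+16` whose last surface visit before the end is
at time `j+2` and which admits a fresh eleven-step continuation ends with one of TWENTY-SIX excursions: the tables `Fourteen.TX s`, `Fourteen.TY s`
(`s : Fin 26`) of `HexSAWSurfaceFourteenSeeds`, read after `x = X_{j+2}` in the direction `σ = X_{j+2} − X_{j+1}` (twenty-two wall bridges, two
overshooting hooks, two excursions turning under the start). [cite: EntingJensen2009, §7.4.2, Fig. 7.10 (brickwork form of the honeycomb lattice); HammersleyTorrieWhittington1982, §2] -/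
theorem fourteen_coords11 {j : ℕ} (hj : 9 ≤ j) (hω : ω ∈ fibW (j + 12) (j + 2)) (hE : ExtK k (j + 16) ω) (hk : 11 ≤ k) :
    ∃ s : Fin 26, ∀ i ≤ 14, ω (j + 2 + i) 0 = ω (j + 2) 0 + Fourteen.TX s i * (ω (j + 2) 0 - ω (j + 1) 0) ∧ ω (j + 2 + i) 1 = Fourteen.TY s i := by
  have hω' : ω ∈ fibW (j + 12) (j + 2) := hω
  obtain ⟨hωh, -, hend, -, hk2, hkY, hno, -⟩ := fibW_anatomy hω'
  rw [show j + 12 + 4 = j + 16 by omega] at hωh hend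
  obtain ⟨hωs, -⟩ := mem_hpw.1 hωh
  have hparx : (ω (j + 2) 0 + ω (j + 2) 1) % 2 = ((j + 2 : ℕ) : ℤ) % 2 := parity_apply hωs (i := j + 2) (by omega)
  have hxe : ω (j + 2) 0 % 2 = 0 := by rw [hkY, add_zero] at hparx; push_cast at hparx; omega
  obtain ⟨hY1, hX2⟩ := surface_prev_step hωh (i := j + 1) (by omega) (by omega) (by rw [show j + 1 + 1 = j + 2 by omega]; exact hkY)
  rw [show j + 1 + 1 = j + 2 by omega] at hX2
  have hno' : ∀ i, j + 2 < i → i ≤ j + 14 → ¬ (i % 2 = 0 ∧ ω i 1 = 0) := fun i h1 h2 => hno i h1 (by omega)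
  exact fourteen_main_gen hj hωh hend hkY hno' hE hk hX2 hY1 hxe (by omega)

open Classical in
/-- ★★ **The fourteen-fibre under `k`-step extendability (`k ≥ 11`) weighs at most `26y · X^{(k)}_{j+2}(y)`** (`j ≥ 9`, `y ≥ 0`).
[cite: HammersleyTorrieWhittington1982, §2; EntingJensen2009, §7.4.2, Fig. 7.10] -/
theorem sum_fibW_fourteen_le_XK {j : ℕ} (hj : 9 ≤ j) (hy : 0 ≤ y) (hk : 11 ≤ k) :
    ∑ ω ∈ (fibW (j + 12) (j + 2)).filter (ExtK k (j + 16)), y ^ visits (j + 16) ω ≤ 26 * y * XKw k (j + 2) y := by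
  set S := (fibW (j + 12) (j + 2)).filter (ExtK k (j + 16)) with hS
  haveI dec : ∀ s : Fin 26, DecidablePred (fun ω : ℕ → Site 2 => ∀ i ≤ 14,
      ω (j + 2 + i) 0 = ω (j + 2) 0 + Fourteen.TX s i * (ω (j + 2) 0 - ω (j + 1) 0) ∧ ω (j + 2 + i) 1 = Fourteen.TY s i) :=
    fun s => Classical.decPred _
  set T : Fin 26 → Finset (ℕ → Site 2) := fun s => S.filter (fun ω => ∀ i ≤ 14,
    ω (j + 2 + i) 0 = ω (j + 2) 0 + Fourteen.TX s i * (ω (j + 2) 0 - ω (j + 1) 0) ∧ ω (j + 2 + i) 1 = Fourteen.TY s i) with hT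
  have hshape : ∀ s, ∑ ω ∈ T s, y ^ visits (j + 16) ω ≤ y * XKw k (j + 2) y := fun s =>
    sum_shape_le_XK' (c := 12) (k := k) hy (Fourteen.TX s) (Fourteen.TY s) _ (Finset.filter_subset _ _) fun ω hω => (Finset.mem_filter.1 hω).2
  have hf : ∀ ω : ℕ → Site 2, 0 ≤ y ^ visits (j + 16) ω := fun _ => pow_nonneg hy _
  have hcover : S ⊆ Finset.univ.biUnion T := by
    intro ω hω
    obtain ⟨hωf, hE⟩ := Finset.mem_filter.1 hω
    obtain ⟨s, hs⟩ := fourteen_coords11 hj hωf hE hk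
    exact Finset.mem_biUnion.2 ⟨s, Finset.mem_univ _, Finset.mem_filter.2 ⟨hω, hs⟩⟩
  -- union bound over the 26 classes by induction-free bookkeeping: `Finset.sum_biUnion_le`-type estimate
  have hU : ∑ ω ∈ Finset.univ.biUnion T, y ^ visits (j + 16) ω ≤ ∑ s : Fin 26, ∑ ω ∈ T s, y ^ visits (j + 16) ω := by
    classical
    refine Finset.induction_on (Finset.univ : Finset (Fin 26)) (by simp) ?_
    intro a s ha ih
    rw [Finset.biUnion_insert, Finset.sum_insert ha]
    have h1 : ∑ ω ∈ T a ∪ s.biUnion T, y ^ visits (j + 16) ω ≤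
        ∑ ω ∈ T a, y ^ visits (j + 16) ω + ∑ ω ∈ s.biUnion T, y ^ visits (j + 16) ω := by
      rw [← Finset.sum_union_inter]
      have : 0 ≤ ∑ ω ∈ T a ∩ s.biUnion T, y ^ visits (j + 16) ω := Finset.sum_nonneg fun ω _ => hf ω
      linarith
    linarith
  calc ∑ ω ∈ S, y ^ visits (j + 16) ω ≤ ∑ ω ∈ Finset.univ.biUnion T, y ^ visits (j + 16) ω :=
        Finset.sum_le_sum_of_subset_of_nonneg hcover fun ω _ _ => hf ω
    _ ≤ ∑ s : Fin 26, ∑ ω ∈ T s, y ^ visits (j + 16) ω := hU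
    _ ≤ ∑ _s : Fin 26, y * XKw k (j + 2) y := Finset.sum_le_sum fun s _ => hshape s
    _ = 26 * y * XKw k (j + 2) y := by rw [Finset.sum_const, Finset.card_univ, Fintype.card_fin]; ring

/-! ### The recursion for the eleven-step-extendable count and the growth bound -/

open Classical in
/-- ★★ **THE RECURSION** (`y ≥ 0`, `j ≥ 9`, arches of length `j+16`):
`X¹¹_{j+16} ≤ y X¹¹_{j+14} + y X¹¹_{j+10} + y X¹¹_{j+8} + 4y X¹¹_{j+6} + 9y X¹¹_{j+4} + 26y X¹¹_{j+2} + 2y Σ_{t ≤ j} X¹¹_t c_{j+15−t}(ℍ)` — characteristic equation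
`1 = yz + yz³ + yz⁴ + 4yz⁵ + 9yz⁶ + 26yz⁷ + O(yz⁸)` at `z = β⁻²`. [cite: HammersleyTorrieWhittington1982, §2; JansevanRensburg2000, §3.3.2, Lemma 3.20; MadrasSlade1993, §1.2, (1.2.3)] -/
theorem X11w_le_rec {j : ℕ} (hj : 9 ≤ j) (hy : 0 ≤ y) :
    XKw 11 (j + 16) y ≤ y * XKw 11 (j + 14) y + y * XKw 11 (j + 10) y + y * XKw 11 (j + 8) y + 4 * y * XKw 11 (j + 6) y + 9 * y * XKw 11 (j + 4) y +
      26 * y * XKw 11 (j + 2) y + 2 * y * ∑ t ∈ range (j + 1), XKw 11 t y * #(saws (j + 15 - t)) := by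
  classical
  set T : ℕ → ℝ := fun t => ∑ ω ∈ (archsK 11 (j + 16)).filter (fun ω => lastV (j + 14) ω = t), y ^ visits (j + 16) ω with hT
  have hf : ∀ ω ∈ archsK 11 (j + 16), lastV (j + 14) ω ∈ range (j + 15) :=
    fun ω _ => Finset.mem_range.2 (Nat.lt_succ_of_le (lastV_le _ _))
  have hX : XKw 11 (j + 16) y = ∑ t ∈ range (j + 15), T t := by
    rw [XKw, ← Finset.sum_fiberwise_of_maps_to hf]
  have hsub : ∀ t, (archsK 11 (j + 16)).filter (fun ω => lastV (j + 14) ω = t) ⊆ (fibW (j + 12) t).filter (ExtK 11 (j + 16)) := by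
    intro t ω hω
    obtain ⟨hωX, hl⟩ := Finset.mem_filter.1 hω
    obtain ⟨hωa, hE⟩ := mem_archsK.1 hωX
    refine Finset.mem_filter.2 ⟨Finset.mem_filter.2 ⟨?_, ?_⟩, hE⟩
    · rw [show j + 12 + 4 = j + 16 by omega]; exact hωa
    · rw [show j + 12 + 2 = j + 14 by omega]; exact hl
  have hTle : ∀ t, T t ≤ ∑ ω ∈ fibW (j + 12) t, y ^ visits (j + 16) ω := fun t =>
    Finset.sum_le_sum_of_subset_of_nonneg ((hsub t).trans (Finset.filter_subset _ _)) fun _ _ _ => pow_nonneg hy _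
  have hTle' : ∀ t, T t ≤ ∑ ω ∈ (fibW (j + 12) t).filter (ExtK 11 (j + 16)), y ^ visits (j + 16) ω := fun t =>
    Finset.sum_le_sum_of_subset_of_nonneg (hsub t) fun _ _ _ => pow_nonneg hy _
  have hT0 : ∀ ω : ℕ → Site 2, visits (j + 12 + 4) ω = visits (j + 16) ω := fun ω => by rw [show j + 12 + 4 = j + 16 by omega]
  have h14 : T (j + 14) ≤ y * XKw 11 (j + 14) y := by
    refine (hTle' _).trans ?_
    have h := sum_fibW_self_le_XK (k := 11) (j + 12) hy
    rw [show j + 12 + 2 = j + 14 by omega] at h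
    simpa only [hT0] using h
  have hodd : ∀ t, (t + j) % 2 = 1 → T t ≤ 0 := fun t ht => (hTle _).trans (by
    refine (Finset.sum_eq_zero fun ω hω => ?_).le
    obtain ⟨-, hm, -, -, hk0, -⟩ := fibW_anatomy hω
    omega)
  have h13 : T (j + 13) ≤ 0 := hodd _ (by omega)
  have h12 : T (j + 12) ≤ 0 := (hTle _).trans (by
    have h := sum_fibW_eq_zero_of_near (m := j + 12) (k := j + 12) (by omega) (by omega) y
    simpa only [hT0] using h.le)
  have h11 : T (j + 11) ≤ 0 := hodd _ (by omega)
  have h9 : T (j + 9) ≤ 0 := hodd _ (by omega)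
  have h7 : T (j + 7) ≤ 0 := hodd _ (by omega)
  have h5 : T (j + 5) ≤ 0 := hodd _ (by omega)
  have h3 : T (j + 3) ≤ 0 := hodd _ (by omega)
  have h1 : T (j + 1) ≤ 0 := hodd _ (by omega)
  have h10 : T (j + 10) ≤ y * XKw 11 (j + 10) y := by
    refine (hTle' _).trans ?_
    have h := sum_fibW_dip_le_XK' (k := 11) (j + 8) hy (by norm_num)
    rw [show j + 8 + 4 = j + 12 by omega, show j + 8 + 2 = j + 10 by omega, show j + 8 + 8 = j + 16 by omega] at h
    exact h
  have h8 : T (j + 8) ≤ y * XKw 11 (j + 8) y := by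
    refine (hTle' _).trans ?_
    have h := sum_fibW_flat8_le_XK' (k := 11) (j := j + 6) (by omega) hy (by norm_num)
    rw [show j + 6 + 6 = j + 12 by omega, show j + 6 + 2 = j + 8 by omega, show j + 6 + 10 = j + 16 by omega] at h
    exact h
  have h6 : T (j + 6) ≤ 4 * y * XKw 11 (j + 6) y := by
    refine (hTle' _).trans ?_
    have h := sum_fibW_ten_le_XK (k := 11) (j := j + 4) (by omega) hy (by norm_num)
    rw [show j + 4 + 8 = j + 12 by omega, show j + 4 + 2 = j + 6 by omega, show j + 4 + 12 = j + 16 by omega] at h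
    exact h
  have h4 : T (j + 4) ≤ 9 * y * XKw 11 (j + 4) y := by
    refine (hTle' _).trans ?_
    have h := sum_fibW_twelve_le_XK (k := 11) (j := j + 2) (by omega) hy (by norm_num)
    rw [show j + 2 + 10 = j + 12 by omega, show j + 2 + 2 = j + 4 by omega, show j + 2 + 14 = j + 16 by omega] at h
    exact h
  have h2 : T (j + 2) ≤ 26 * y * XKw 11 (j + 2) y := (hTle' _).trans (sum_fibW_fourteen_le_XK hj hy le_rfl)
  have h0 : ∑ t ∈ range (j + 1), T t ≤ 2 * y * ∑ t ∈ range (j + 1), XKw 11 t y * #(saws (j + 15 - t)) := by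
    rw [Finset.mul_sum]
    refine Finset.sum_le_sum fun t ht => (hTle t).trans ?_
    have ht' := Finset.mem_range.1 ht
    have h := sum_fibW_le_XK (k := 11) (j + 12) hy (t := t) (by omega)
    rw [show j + 12 + 3 - t = j + 15 - t by omega] at h
    simpa only [hT0] using h
  rw [hX, Finset.sum_range_succ, Finset.sum_range_succ, Finset.sum_range_succ, Finset.sum_range_succ, Finset.sum_range_succ,
    Finset.sum_range_succ, Finset.sum_range_succ, Finset.sum_range_succ, Finset.sum_range_succ, Finset.sum_range_succ,
    Finset.sum_range_succ, Finset.sum_range_succ, Finset.sum_range_succ, Finset.sum_range_succ]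
  linarith

open Classical in
/-- **The growth bound** (`y ≥ 1`): if `ρ ≥ 6` and `y/ρ² + y/ρ⁶ + y/ρ⁸ + 4y/ρ¹⁰ + 9y/ρ¹² + 26y/ρ¹⁴ + 57395628·y/ρ¹⁶ ≤ 1` then `X¹¹_n(y) ≤ 3²⁴ y²⁴ · ρⁿ`
for every `n` (strong induction on `X11w_le_rec` from `n = 25`; `c_m(ℍ) ≤ 3^m`; geometric tail `Σ_{t ≤ j} ρ^t 3^{j+15−t} ≤ 2·3¹⁵ ρ^j`; `57395628 = 4·3¹⁵`).
[cite: HammersleyTorrieWhittington1982, §2; MadrasSlade1993, §1.2, Lemma 1.2.2] -/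
theorem X11w_le_mul_pow (hy : 1 ≤ y) {ρ : ℝ} (hρ : 6 ≤ ρ)
    (hc : y / ρ ^ 2 + y / ρ ^ 6 + y / ρ ^ 8 + 4 * y / ρ ^ 10 + 9 * y / ρ ^ 12 + 26 * y / ρ ^ 14 + 57395628 * y / ρ ^ 16 ≤ 1)
    (n : ℕ) : XKw 11 n y ≤ 3 ^ 24 * y ^ 24 * ρ ^ n := by
  have hy0 : 0 ≤ y := by linarith
  have hρ1 : 1 ≤ ρ := by linarith
  have hρ0 : 0 < ρ := by linarith
  induction n using Nat.strong_induction_on with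
  | _ n ih =>
  rcases Nat.lt_or_ge n 25 with hn | hn
  · have h1 := XKw_le_three_pow_mul_pow 11 n hy
    have h3 : (3 : ℝ) ^ n ≤ 3 ^ 24 := pow_le_pow_right₀ (by norm_num) (by omega)
    have h4 : y ^ n ≤ y ^ 24 := pow_le_pow_right₀ hy (by omega)
    have h5 : (1 : ℝ) ≤ ρ ^ n := one_le_pow₀ hρ1
    calc XKw 11 n y ≤ 3 ^ n * y ^ n := h1
      _ ≤ 3 ^ 24 * y ^ 24 := mul_le_mul h3 h4 (pow_nonneg hy0 _) (by positivity)
      _ = 3 ^ 24 * y ^ 24 * 1 := (mul_one _).symm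
      _ ≤ 3 ^ 24 * y ^ 24 * ρ ^ n := mul_le_mul_of_nonneg_left h5 (by positivity)
  · obtain ⟨j, rfl⟩ : ∃ j, n = j + 16 := ⟨n - 16, by omega⟩
    set M : ℝ := 3 ^ 24 * y ^ 24 with hM
    have hM0 : 0 ≤ M := by positivity
    have hrec := X11w_le_rec (j := j) (by omega) hy0
    have b14 : XKw 11 (j + 14) y ≤ M * ρ ^ (j + 14) := ih (j + 14) (by omega)
    have b10 : XKw 11 (j + 10) y ≤ M * ρ ^ (j + 10) := ih (j + 10) (by omega)
    have b8 : XKw 11 (j + 8) y ≤ M * ρ ^ (j + 8) := ih (j + 8) (by omega)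
    have b6 : XKw 11 (j + 6) y ≤ M * ρ ^ (j + 6) := ih (j + 6) (by omega)
    have b4 : XKw 11 (j + 4) y ≤ M * ρ ^ (j + 4) := ih (j + 4) (by omega)
    have b2 : XKw 11 (j + 2) y ≤ M * ρ ^ (j + 2) := ih (j + 2) (by omega)
    have bS : ∑ t ∈ range (j + 1), XKw 11 t y * (#(saws (j + 15 - t)) : ℝ) ≤ M * (2 * 3 ^ 15 * ρ ^ j) := by
      calc ∑ t ∈ range (j + 1), XKw 11 t y * (#(saws (j + 15 - t)) : ℝ)
          ≤ ∑ t ∈ range (j + 1), M * ρ ^ t * 3 ^ (j + 15 - t) := by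
            refine Finset.sum_le_sum fun t ht => ?_
            exact mul_le_mul (ih t (by have := Finset.mem_range.1 ht; omega)) (Arm.card_saws_le_three_pow _)
              (by positivity) (by positivity)
        _ = M * ∑ t ∈ range (j + 1), ρ ^ t * 3 ^ (j + 15 - t) := by
            rw [Finset.mul_sum]; exact Finset.sum_congr rfl fun t _ => by ring
        _ ≤ M * (2 * 3 ^ 15 * ρ ^ j) := mul_le_mul_of_nonneg_left (Arm.sum_pow_mul_three_pow_le hρ j 15) hM0
    have key : y * ρ ^ (j + 14) + y * ρ ^ (j + 10) + y * ρ ^ (j + 8) + 4 * y * ρ ^ (j + 6) + 9 * y * ρ ^ (j + 4) + 26 * y * ρ ^ (j + 2) +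
        57395628 * y * ρ ^ j ≤ ρ ^ (j + 16) := by
      have h := mul_le_mul_of_nonneg_right hc (pow_nonneg hρ0.le (j + 16))
      rw [one_mul] at h
      have e : (y / ρ ^ 2 + y / ρ ^ 6 + y / ρ ^ 8 + 4 * y / ρ ^ 10 + 9 * y / ρ ^ 12 + 26 * y / ρ ^ 14 + 57395628 * y / ρ ^ 16) * ρ ^ (j + 16) =
          y * ρ ^ (j + 14) + y * ρ ^ (j + 10) + y * ρ ^ (j + 8) + 4 * y * ρ ^ (j + 6) + 9 * y * ρ ^ (j + 4) + 26 * y * ρ ^ (j + 2) +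
            57395628 * y * ρ ^ j := by
        field_simp
        ring
      linarith
    have c14 := mul_le_mul_of_nonneg_left b14 hy0
    have c10 := mul_le_mul_of_nonneg_left b10 hy0
    have c8 := mul_le_mul_of_nonneg_left b8 hy0
    have c6 : 4 * y * XKw 11 (j + 6) y ≤ 4 * y * (M * ρ ^ (j + 6)) := mul_le_mul_of_nonneg_left b6 (by positivity)
    have c4 : 9 * y * XKw 11 (j + 4) y ≤ 9 * y * (M * ρ ^ (j + 4)) := mul_le_mul_of_nonneg_left b4 (by positivity)
    have c2 : 26 * y * XKw 11 (j + 2) y ≤ 26 * y * (M * ρ ^ (j + 2)) := mul_le_mul_of_nonneg_left b2 (by positivity)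
    have cS : 2 * y * ∑ t ∈ range (j + 1), XKw 11 t y * (#(saws (j + 15 - t)) : ℝ) ≤ 2 * y * (M * (2 * 3 ^ 15 * ρ ^ j)) :=
      mul_le_mul_of_nonneg_left bS (by positivity)
    have key' := mul_le_mul_of_nonneg_left key hM0
    calc XKw 11 (j + 16) y
        ≤ y * XKw 11 (j + 14) y + y * XKw 11 (j + 10) y + y * XKw 11 (j + 8) y + 4 * y * XKw 11 (j + 6) y + 9 * y * XKw 11 (j + 4) y +
            26 * y * XKw 11 (j + 2) y + 2 * y * ∑ t ∈ range (j + 1), XKw 11 t y * (#(saws (j + 15 - t)) : ℝ) := hrec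
      _ ≤ y * (M * ρ ^ (j + 14)) + y * (M * ρ ^ (j + 10)) + y * (M * ρ ^ (j + 8)) + 4 * y * (M * ρ ^ (j + 6)) + 9 * y * (M * ρ ^ (j + 4)) +
            26 * y * (M * ρ ^ (j + 2)) + 2 * y * (M * (2 * 3 ^ 15 * ρ ^ j)) := by linarith
      _ = M * (y * ρ ^ (j + 14) + y * ρ ^ (j + 10) + y * ρ ^ (j + 8) + 4 * y * ρ ^ (j + 6) + 9 * y * ρ ^ (j + 4) + 26 * y * ρ ^ (j + 2) +
            57395628 * y * ρ ^ j) := by ring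
      _ ≤ M * ρ ^ (j + 16) := key'

/-! ### THE SIXTH-ORDER UPPER WINDOW -/

set_option maxHeartbeats 400000 in
/-- The polynomial inequality behind the renewal condition: for `y ≥ 1` the degree-25 slack polynomial is nonnegative (all its coefficients in
`y − 1` are positive). [cite: JansevanRensburg2000, §3.3.2, Lemma 3.20] -/
theorem sixth_poly_nonneg (hy : 1 ≤ y) :
    0 ≤ 60 * y ^ 25 - 63 * y ^ 24 + 544 * y ^ 23 - 138 * y ^ 22 + 2168 * y ^ 21 + 879 * y ^ 20 + 6137 * y ^ 19 + 5508 * y ^ 18 +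
      14492 * y ^ 17 + 16683 * y ^ 16 + 28341 * y ^ 15 + 34579 * y ^ 14 + 45089 * y ^ 13 + 52604 * y ^ 12 + 57163 * y ^ 11 + 59982 * y ^ 10 +
      55974 * y ^ 9 + 50918 * y ^ 8 + 40787 * y ^ 7 + 30957 * y ^ 6 + 21005 * y ^ 5 + 12463 * y ^ 4 + 6876 * y ^ 3 + 2900 * y ^ 2 + 1072 * y + 288 := by
  obtain ⟨z, hz, rfl⟩ : ∃ z : ℝ, 0 ≤ z ∧ y = z + 1 := ⟨y - 1, by linarith, by ring⟩
  have e : 60 * (z + 1) ^ 25 - 63 * (z + 1) ^ 24 + 544 * (z + 1) ^ 23 - 138 * (z + 1) ^ 22 + 2168 * (z + 1) ^ 21 + 879 * (z + 1) ^ 20 +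
      6137 * (z + 1) ^ 19 + 5508 * (z + 1) ^ 18 + 14492 * (z + 1) ^ 17 + 16683 * (z + 1) ^ 16 + 28341 * (z + 1) ^ 15 + 34579 * (z + 1) ^ 14 +
      45089 * (z + 1) ^ 13 + 52604 * (z + 1) ^ 12 + 57163 * (z + 1) ^ 11 + 59982 * (z + 1) ^ 10 + 55974 * (z + 1) ^ 9 + 50918 * (z + 1) ^ 8 +
      40787 * (z + 1) ^ 7 + 30957 * (z + 1) ^ 6 + 21005 * (z + 1) ^ 5 + 12463 * (z + 1) ^ 4 + 6876 * (z + 1) ^ 3 + 2900 * (z + 1) ^ 2 +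
      1072 * (z + 1) + 288 =
      60 * z ^ 25 + 1437 * z ^ 24 + 17032 * z ^ 23 + 132986 * z ^ 22 + 768252 * z ^ 21 + 3496315 * z ^ 20 + 13031845 * z ^ 19 +
      40830599 * z ^ 18 + 109511627 * z ^ 17 + 254740552 * z ^ 16 + 518768681 * z ^ 15 + 931004782 * z ^ 14 + 1478835340 * z ^ 13 +
      2084119155 * z ^ 12 + 2607528108 * z ^ 11 + 2892948465 * z ^ 10 + 2837552151 * z ^ 9 + 2447902225 * z ^ 8 + 1842923968 * z ^ 7 +
      1197305244 * z ^ 6 + 660546348 * z ^ 5 + 302290000 * z ^ 4 + 110731880 * z ^ 3 + 30618140 * z ^ 2 + 5721588 * z + 547268 := by ring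
  rw [e]
  positivity

set_option maxHeartbeats 400000 in
/-- **The renewal condition at `B = y + 1/y + 1/y² + 2/y³ + 4/y⁴ + 6/y⁵ + 57395700/y⁶`** (`y ≥ 1`):
`y/B + y/B³ + y/B⁴ + 4y/B⁵ + 9y/B⁶ + 26y/B⁷ + 57395628·y/B⁸ ≤ 1`.  The cancellations — in `y/B² = 1/y − 2/y³ − 2/y⁴ − 1/y⁵ − 2/y⁶ …`,
`y/B³ = 1/y² − 3/y⁴ − 3/y⁵ + 0/y⁶ …`, `4y/B⁴ = 4/y³ − 16/y⁵ − 16/y⁶ …`, `9y/B⁵ = 9/y⁴ − 45/y⁶ …` — are handled with `B ≥ y + 1/y + 1/y² + 2/y³`,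
`B ≥ y + 1/y + 1/y²`, `B ≥ y + 1/y` and `B ≥ y`; what remains is `sixth_poly_nonneg`. [cite: JansevanRensburg2000, §3.3.2, Lemma 3.20; MadrasSlade1993, §1.2, Lemma 1.2.2] -/
theorem sixthB_condition (hy : 1 ≤ y) :
    y / (y + 1 / y + 1 / y ^ 2 + 2 / y ^ 3 + 4 / y ^ 4 + 6 / y ^ 5 + 57395700 / y ^ 6) +
        y / (y + 1 / y + 1 / y ^ 2 + 2 / y ^ 3 + 4 / y ^ 4 + 6 / y ^ 5 + 57395700 / y ^ 6) ^ 3 +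
        y / (y + 1 / y + 1 / y ^ 2 + 2 / y ^ 3 + 4 / y ^ 4 + 6 / y ^ 5 + 57395700 / y ^ 6) ^ 4 +
        4 * y / (y + 1 / y + 1 / y ^ 2 + 2 / y ^ 3 + 4 / y ^ 4 + 6 / y ^ 5 + 57395700 / y ^ 6) ^ 5 +
        9 * y / (y + 1 / y + 1 / y ^ 2 + 2 / y ^ 3 + 4 / y ^ 4 + 6 / y ^ 5 + 57395700 / y ^ 6) ^ 6 +
        26 * y / (y + 1 / y + 1 / y ^ 2 + 2 / y ^ 3 + 4 / y ^ 4 + 6 / y ^ 5 + 57395700 / y ^ 6) ^ 7 +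
        57395628 * y / (y + 1 / y + 1 / y ^ 2 + 2 / y ^ 3 + 4 / y ^ 4 + 6 / y ^ 5 + 57395700 / y ^ 6) ^ 8 ≤ 1 := by
  have hy0 : 0 < y := by linarith
  set B : ℝ := y + 1 / y + 1 / y ^ 2 + 2 / y ^ 3 + 4 / y ^ 4 + 6 / y ^ 5 + 57395700 / y ^ 6 with hB
  set u : ℝ := 1 / y + 1 / y ^ 2 + 2 / y ^ 3 + 4 / y ^ 4 + 6 / y ^ 5 + 57395700 / y ^ 6 with hu
  have hBu : B = y + u := by rw [hB, hu]; ring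
  have hp1 : (0 : ℝ) < 1 / y := by positivity
  have hp2 : (0 : ℝ) < 1 / y ^ 2 := by positivity
  have hp3 : (0 : ℝ) < 2 / y ^ 3 := by positivity
  have hp4 : (0 : ℝ) ≤ 4 / y ^ 4 := by positivity
  have hp5 : (0 : ℝ) ≤ 6 / y ^ 5 := by positivity
  have hp6 : (0 : ℝ) ≤ 57395700 / y ^ 6 := by positivity
  have hyB : y ≤ B := by rw [hB]; linarith
  have hB1 : y + 1 / y ≤ B := by rw [hB]; linarith
  have hB2 : y + 1 / y + 1 / y ^ 2 ≤ B := by rw [hB]; linarith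
  have hB3 : y + 1 / y + 1 / y ^ 2 + 2 / y ^ 3 ≤ B := by rw [hB]; linarith
  have hB0 : 0 < B := by linarith
  have t1 : y / B ^ 2 ≤ y ^ 7 / (y ^ 4 + y ^ 2 + y + 2) ^ 2 := by
    have e : y ^ 7 / (y ^ 4 + y ^ 2 + y + 2) ^ 2 = y / (y + 1 / y + 1 / y ^ 2 + 2 / y ^ 3) ^ 2 := by field_simp
    rw [e]
    exact div_le_div_of_nonneg_left hy0.le (by positivity) (pow_le_pow_left₀ (by positivity) hB3 2)
  have t2 : y / B ^ 3 ≤ y ^ 7 / (y ^ 3 + y + 1) ^ 3 := by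
    have e : y ^ 7 / (y ^ 3 + y + 1) ^ 3 = y / (y + 1 / y + 1 / y ^ 2) ^ 3 := by field_simp
    rw [e]
    exact div_le_div_of_nonneg_left hy0.le (by positivity) (pow_le_pow_left₀ (by positivity) hB2 3)
  have t3 : 4 * y / B ^ 4 ≤ 4 * y ^ 5 / (y ^ 2 + 1) ^ 4 := by
    have e : 4 * y ^ 5 / (y ^ 2 + 1) ^ 4 = 4 * y / (y + 1 / y) ^ 4 := by field_simp
    rw [e]
    exact div_le_div_of_nonneg_left (by positivity) (by positivity) (pow_le_pow_left₀ (by positivity) hB1 4)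
  have t4 : 9 * y / B ^ 5 ≤ 9 / y ^ 4 := by
    rw [div_le_div_iff₀ (by positivity) (by positivity)]
    calc 9 * y * y ^ 4 = 9 * y ^ 5 := by ring
      _ ≤ 9 * B ^ 5 := mul_le_mul_of_nonneg_left (pow_le_pow_left₀ hy0.le hyB 5) (by norm_num)
  have t5 : 26 * y / B ^ 6 ≤ 26 / y ^ 5 := by
    rw [div_le_div_iff₀ (by positivity) (by positivity)]
    calc 26 * y * y ^ 5 = 26 * y ^ 6 := by ring
      _ ≤ 26 * B ^ 6 := mul_le_mul_of_nonneg_left (pow_le_pow_left₀ hy0.le hyB 6) (by norm_num)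
  have t6 : 57395628 * y / B ^ 7 ≤ 57395628 / y ^ 6 := by
    rw [div_le_div_iff₀ (by positivity) (by positivity)]
    calc 57395628 * y * y ^ 6 = 57395628 * y ^ 7 := by ring
      _ ≤ 57395628 * B ^ 7 := mul_le_mul_of_nonneg_left (pow_le_pow_left₀ hy0.le hyB 7) (by norm_num)
  have poly : y ^ 7 / (y ^ 4 + y ^ 2 + y + 2) ^ 2 + y ^ 7 / (y ^ 3 + y + 1) ^ 3 + 4 * y ^ 5 / (y ^ 2 + 1) ^ 4 + 9 / y ^ 4 + 26 / y ^ 5 +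
      57395628 / y ^ 6 ≤ u := by
    rw [hu, ← sub_nonneg]
    have e : 1 / y + 1 / y ^ 2 + 2 / y ^ 3 + 4 / y ^ 4 + 6 / y ^ 5 + 57395700 / y ^ 6 -
        (y ^ 7 / (y ^ 4 + y ^ 2 + y + 2) ^ 2 + y ^ 7 / (y ^ 3 + y + 1) ^ 3 + 4 * y ^ 5 / (y ^ 2 + 1) ^ 4 + 9 / y ^ 4 + 26 / y ^ 5 +
          57395628 / y ^ 6) =
        (60 * y ^ 25 - 63 * y ^ 24 + 544 * y ^ 23 - 138 * y ^ 22 + 2168 * y ^ 21 + 879 * y ^ 20 + 6137 * y ^ 19 + 5508 * y ^ 18 +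
          14492 * y ^ 17 + 16683 * y ^ 16 + 28341 * y ^ 15 + 34579 * y ^ 14 + 45089 * y ^ 13 + 52604 * y ^ 12 + 57163 * y ^ 11 +
          59982 * y ^ 10 + 55974 * y ^ 9 + 50918 * y ^ 8 + 40787 * y ^ 7 + 30957 * y ^ 6 + 21005 * y ^ 5 + 12463 * y ^ 4 + 6876 * y ^ 3 +
          2900 * y ^ 2 + 1072 * y + 288) / (y ^ 6 * (y ^ 4 + y ^ 2 + y + 2) ^ 2 * (y ^ 3 + y + 1) ^ 3 * (y ^ 2 + 1) ^ 4) := by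
      field_simp
      ring
    rw [e]
    exact div_nonneg (sixth_poly_nonneg hy) (by positivity)
  have hBy : B - y = u := by rw [hBu]; ring
  have hsum : y / B ^ 2 + y / B ^ 3 + 4 * y / B ^ 4 + 9 * y / B ^ 5 + 26 * y / B ^ 6 + 57395628 * y / B ^ 7 ≤ B - y := by rw [hBy]; linarith
  have e : y / B + y / B ^ 3 + y / B ^ 4 + 4 * y / B ^ 5 + 9 * y / B ^ 6 + 26 * y / B ^ 7 + 57395628 * y / B ^ 8 =
      (y + (y / B ^ 2 + y / B ^ 3 + 4 * y / B ^ 4 + 9 * y / B ^ 5 + 26 * y / B ^ 6 + 57395628 * y / B ^ 7)) / B := by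
    field_simp
    ring
  rw [e, div_le_one hB0]
  linarith

/-- ★★★ **THE SIXTH-ORDER UPPER WINDOW: `β(y)² ≤ y + 1/y + 1/y² + 2/y³ + 4/y⁴ + 6/y⁵ + 57395700/y⁶` for every `y ≥ 36`** (eleven-step-extendable
arches; the threshold only serves `ρ ≥ 6`). [cite: BeatonBousquetMelouDeGierDuminilCopinGuttmann2014, §3.1, Proposition 5 (arXiv v5 p. 9) and p. 10 (first-order remark, stated without proof); JansevanRensburg2000, §3.3.2, Lemma 3.20] -/
theorem wallRate_sq_le_sixth (hy : 36 ≤ y) :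
    wallRate y ^ 2 ≤ y + 1 / y + 1 / y ^ 2 + 2 / y ^ 3 + 4 / y ^ 4 + 6 / y ^ 5 + 57395700 / y ^ 6 := by
  have hy1 : 1 ≤ y := by linarith
  have hy0 : 0 < y := by linarith
  set B : ℝ := y + 1 / y + 1 / y ^ 2 + 2 / y ^ 3 + 4 / y ^ 4 + 6 / y ^ 5 + 57395700 / y ^ 6 with hB
  have hyB : y ≤ B := by
    have h1 : (0 : ℝ) ≤ 1 / y := by positivity
    have h2 : (0 : ℝ) ≤ 1 / y ^ 2 := by positivity
    have h3 : (0 : ℝ) ≤ 2 / y ^ 3 := by positivity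
    have h4 : (0 : ℝ) ≤ 4 / y ^ 4 := by positivity
    have h5 : (0 : ℝ) ≤ 6 / y ^ 5 := by positivity
    have h6 : (0 : ℝ) ≤ 57395700 / y ^ 6 := by positivity
    rw [hB]; linarith
  have hB36 : 36 ≤ B := hy.trans hyB
  have hB0 : 0 < B := by linarith
  set ρ := Real.sqrt B with hρ
  have hρ0 : 0 < ρ := Real.sqrt_pos.2 hB0
  have hρsq : ρ ^ 2 = B := Real.sq_sqrt hB0.le
  have hρ6 : 6 ≤ ρ := by
    rw [hρ, ← Real.sqrt_sq (by norm_num : (0 : ℝ) ≤ 6)]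
    exact Real.sqrt_le_sqrt (by norm_num; exact hB36)
  have hc : y / ρ ^ 2 + y / ρ ^ 6 + y / ρ ^ 8 + 4 * y / ρ ^ 10 + 9 * y / ρ ^ 12 + 26 * y / ρ ^ 14 + 57395628 * y / ρ ^ 16 ≤ 1 := by
    have h6 : ρ ^ 6 = B ^ 3 := by rw [show (6 : ℕ) = 2 * 3 by norm_num, pow_mul, hρsq]
    have h8 : ρ ^ 8 = B ^ 4 := by rw [show (8 : ℕ) = 2 * 4 by norm_num, pow_mul, hρsq]
    have h10 : ρ ^ 10 = B ^ 5 := by rw [show (10 : ℕ) = 2 * 5 by norm_num, pow_mul, hρsq]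
    have h12 : ρ ^ 12 = B ^ 6 := by rw [show (12 : ℕ) = 2 * 6 by norm_num, pow_mul, hρsq]
    have h14 : ρ ^ 14 = B ^ 7 := by rw [show (14 : ℕ) = 2 * 7 by norm_num, pow_mul, hρsq]
    have h16 : ρ ^ 16 = B ^ 8 := by rw [show (16 : ℕ) = 2 * 8 by norm_num, pow_mul, hρsq]
    rw [hρsq, h6, h8, h10, h12, h14, h16,
      show y / B = y / (y + 1 / y + 1 / y ^ 2 + 2 / y ^ 3 + 4 / y ^ 4 + 6 / y ^ 5 + 57395700 / y ^ 6) by rw [hB]]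
    exact sixthB_condition hy1
  have hA := X11w_le_mul_pow hy1 hρ6 hc
  have hW : ∀ n, WB n y ≤ 3 ^ 24 * y ^ 24 * ρ ^ n := fun n => (WB_le_XKw 11 n hy0.le).trans (hA n)
  have hβρ : wallRate y ≤ ρ := wallRate_le_of_WB_le hy0 (by positivity) hρ0 hW
  calc wallRate y ^ 2 ≤ ρ ^ 2 := pow_le_pow_left₀ (wallRate_pos y).le hβρ 2
    _ = B := hρsq

/-- ★★★ **`y⁵ · (β(y)² − y − 1/y − 1/y² − 2/y³ − 4/y⁴) ≤ 6 + 57395700/y`** (`y ≥ 36`): `limsup_{y → ∞} y⁵ (β(y)² − y − 1/y − 1/y² − 2/y³ − 4/y⁴) ≤ 6`,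
the lane's census conjecture for the sixth coefficient from above. [cite: BeatonBousquetMelouDeGierDuminilCopinGuttmann2014, §3.1 (arXiv v5 p. 10 remark); JansevanRensburg2000, §3.3.2, Lemma 3.20] -/
theorem pow_five_mul_wallRate_sq_sub_le (hy : 36 ≤ y) :
    y ^ 5 * (wallRate y ^ 2 - y - 1 / y - 1 / y ^ 2 - 2 / y ^ 3 - 4 / y ^ 4) ≤ 6 + 57395700 / y := by
  have hy0 : 0 < y := by linarith
  have h := wallRate_sq_le_sixth hy
  have e : y ^ 5 * (wallRate y ^ 2 - y - 1 / y - 1 / y ^ 2 - 2 / y ^ 3 - 4 / y ^ 4) =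
      y ^ 5 * (wallRate y ^ 2 - (y + 1 / y + 1 / y ^ 2 + 2 / y ^ 3 + 4 / y ^ 4 + 6 / y ^ 5 + 57395700 / y ^ 6)) + (6 + 57395700 / y) := by
    field_simp
    ring
  rw [e]
  have : y ^ 5 * (wallRate y ^ 2 - (y + 1 / y + 1 / y ^ 2 + 2 / y ^ 3 + 4 / y ^ 4 + 6 / y ^ 5 + 57395700 / y ^ 6)) ≤ 0 :=
    mul_nonpos_of_nonneg_of_nonpos (pow_nonneg hy0.le 5) (by linarith)
  linarith

/-- ★★★ **`limsup ≤ 6` in the elementary form**: every `a > 6` eventually dominates `y⁵ (β(y)² − y − 1/y − 1/y² − 2/y³ − 4/y⁴)`.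
[cite: BeatonBousquetMelouDeGierDuminilCopinGuttmann2014, §3.1 (arXiv v5 p. 10 remark); JansevanRensburg2000, §3.3.2, Lemma 3.20] -/
theorem eventually_pow_five_mul_wallRate_sq_sub_le {a : ℝ} (ha : 6 < a) :
    ∀ᶠ y : ℝ in atTop, y ^ 5 * (wallRate y ^ 2 - y - 1 / y - 1 / y ^ 2 - 2 / y ^ 3 - 4 / y ^ 4) ≤ a := by
  have h1 : ∀ᶠ y : ℝ in atTop, 36 ≤ y := eventually_ge_atTop 36
  have h2 : ∀ᶠ y : ℝ in atTop, 57395700 / (a - 6) ≤ y := eventually_ge_atTop _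
  filter_upwards [h1, h2] with y hy hy2
  have hy0 : 0 < y := by linarith
  have h := pow_five_mul_wallRate_sq_sub_le hy
  have h3 : 57395700 / y ≤ a - 6 := by
    rw [div_le_iff₀ hy0]
    have := (div_le_iff₀ (by linarith : (0:ℝ) < a - 6)).1 hy2
    linarith
  linarith

/-- ★★ **The fifth-order window sharpened from above** (`y ≥ 36`): `β(y)² − y − 1/y − 1/y² − 2/y³ − 4/y⁴ ∈ [−53853213/y⁵, 6/y⁵ + 57395700/y⁶]`
(lower end: the tree's fifth-order lower bound). [cite: BeatonBousquetMelouDeGierDuminilCopinGuttmann2014, §3.1, Proposition 5 (arXiv v5 p. 9); p. 10 (first-order remark)] [cite: JansevanRensburg2000, §3.3.2, Lemma 3.20] -/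
theorem wallRate_sq_fifth_mem_Icc' (hy : 36 ≤ y) :
    wallRate y ^ 2 - y - 1 / y - 1 / y ^ 2 - 2 / y ^ 3 - 4 / y ^ 4 ∈ Set.Icc (-(53853213 / y ^ 5)) (6 / y ^ 5 + 57395700 / y ^ 6) := by
  refine ⟨(wallRate_sq_fifth_mem_Icc hy).1, ?_⟩
  have h := wallRate_sq_le_sixth hy
  linarith

/-- ★★★ **`μ(y)² ≤ y + 1/y + 1/y² + 2/y³ + 4/y⁴ + 6/y⁵ + 57395700/y⁶`** (`y ≥ 36`) for BBdGDCG's `μ(y) = HV.surfaceMu y`.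
[cite: BeatonBousquetMelouDeGierDuminilCopinGuttmann2014, §3.1, Proposition 5 (arXiv v5 p. 9); p. 10 (first-order remark)] -/
theorem surfaceMu_sq_le_sixth (hy : 36 ≤ y) :
    HV.surfaceMu y ^ 2 ≤ y + 1 / y + 1 / y ^ 2 + 2 / y ^ 3 + 4 / y ^ 4 + 6 / y ^ 5 + 57395700 / y ^ 6 := by
  rw [← HV.wallRate_eq_surfaceMu (by linarith)]
  exact wallRate_sq_le_sixth hy

/-- ★★★ **`limsup_{y→∞} y⁵ (μ(y)² − y − 1/y − 1/y² − 2/y³ − 4/y⁴) ≤ 6`** for BBdGDCG's `μ(y)` (elementary form).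
[cite: BeatonBousquetMelouDeGierDuminilCopinGuttmann2014, §3.1, Proposition 5 (arXiv v5 p. 9); p. 10 (first-order remark)] [cite: JansevanRensburg2000, §3.3.2, Lemma 3.20] -/
theorem eventually_pow_five_mul_surfaceMu_sq_sub_le {a : ℝ} (ha : 6 < a) :
    ∀ᶠ y : ℝ in atTop, y ^ 5 * (HV.surfaceMu y ^ 2 - y - 1 / y - 1 / y ^ 2 - 2 / y ^ 3 - 4 / y ^ 4) ≤ a := by
  filter_upwards [eventually_pow_five_mul_wallRate_sq_sub_le ha, eventually_gt_atTop 0] with y h hy0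
  rwa [HV.wallRate_eq_surfaceMu hy0] at h

end Literature.Probability.RandomPlanarGeometry.SAW.HexBW.Wall
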